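import Summits.Ventures.CertifiedArithmetic.LowPrec.SRRecursionLimitedBits
import Summits.Ventures.CertifiedArithmetic.LowPrec.SRLimitedBitsOptimal
import HarnessLib

/-!
# Few random bits re-create dead bands: spurious absorbing states of SR recursions under P3109
# StochasticA/B/C with `N` bits

HONEST FRAMING: certified error envelopes and provably optimal rounding/accumulation schemes for
low-precision formats under stated cost models; every table by two implementations; no hardware or
vendor claims.

Round-to-nearest recursions have DEAD BANDS (file III `SRRecursionFormats`: the RN-EMA `x ← RN(βx + (1−β)μ)`
is stuck at every state `y` with `(1−β)|y − μ| < gap/2`); exact SR has none — it is absorbed only AT a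
representable target (`SRRecursionAbsorb`: from the neighbour `2` of `μ = 3/2` in E2M1,
`P(xₙ ≠ 3/2) = (3/4)ⁿ → 0`); and SUMS of small constant increments under `N`-bit SR stagnate below the
resolution `gap/2^{N+1}` (file XXVII `SRLimitedBitsOptimal`: `probAwayA/B/C_eq_zero`, `stagnation_of_gap`).
This file is the RECURSION counterpart: SR implemented with FEW RANDOM BITS has SPURIOUS FIXED POINTS off
the target, on BOTH sides of it (the upper side uses the new sure-away thresholds `probAwayB/C_eq_one`,
which sums never exercise):

1. `recExpQ_absorb`: a state from which every step's one-step law is a point mass is absorbing for the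
   whole limited-randomness tree (`recExpQ`, file LXXIII); `stepQ_absorb_dn/up`: the one-step criteria
   (`dn c = y ∧ P_q(up) = 0`, or `up c = y ∧ P_q(up) = 1`).
2. WHERE THE RULES ARE DETERMINISTIC (`N` random bits, residual `θ = (c − dn)/(up − dn)`): toward zero
   surely for `θ < 2^{-N}` (A), `θ < 2^{-(N+1)}` (B), `θ ≤ 2^{-(N+1)}` (C) — file XXVII; NEW here, the
   away side: StochasticB away surely iff `θ ≥ 1 − 2^{-(N+1)}` (`probAwayB_eq_one`), StochasticC for
   `θ > 1 − 2^{-(N+1)}` (`probAwayC_eq_one`; at the tie to even), `SR_ε` for `θ ≥ 1 − ε` (`qAway_eq_one`),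
   StochasticA NEVER for `θ < 1` (`probAwayA_lt_one`: its comparison is `⌊θ2^N⌋ + R ≥ 2^N`).
3. Consequently (`absorb_dn_of`, `absorb_up_of` + the EMA form `ema_absorb_of_step`): a state `y` of the
   SR-EMA is ABSORBING under StochasticB/C with `N` bits as soon as `(1−β)|y − μ| ≤ 2^{-(N+1)}·gap`
   (strictness as in item 2) — the RN dead band SHRUNK `2^N`-FOLD, but not empty for small `N`; under
   StochasticA only states on the zero side of `μ` (`|y| < |μ|`, rounding toward zero = staying) with
   `(1−β)|y − μ| < 2^{-N}·gap` are absorbing — a ONE-SIDED band twice as wide.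
4. **FP4 (E2M1) kernel witnesses**, EMA `β = 3/4`, `μ = 3/2` (dead band of RN: `{1, 3/2, 2, 3}`, file III):
   one bit — StochasticB is stuck at `2` for ever (`e2m1_ema_B1_stuck_two`), StochasticC at `1` and `2`,
   StochasticA at `1` (not at `2`); from `x₀ = 3` StochasticB has `E xₙ = 2 + 2^{-n} → 2 = μ + 1/2`
   (`e2m1_ema_B1_mean_from_three`; exact SR → `3/2`), StochasticA has `E xₙ = 3/2 + (n+3)/2^{n+1} → 3/2`
   (`e2m1_ema_A1_mean_from_three`); two bits dissolve both spurious states (`e2m1_ema_two_bits_move`).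
   Two-implementation tables: `certs/sr/gen15/ema_fewbits_e2m1`.

Placement. Limited-precision SR analyses ([ElararEtAl2025] `SR_{p,r}`; [FitzgibbonWintersteigerSarnoff2026]
P3109 StochasticA/B/C) bound the per-step BIAS by `2^{-r}u`; the recursion-level consequence made exact
here — few-bit SR has absorbing states off the target, i.e. an `O(1)`-in-time bias of one cell — is the
finite-format mechanism behind "stagnation returns when too few random bits are used".
-/

namespace Summit.Ventures.CertifiedArithmetic.LowPrec.SR

open Literature.ComputerArithmetic.ConnollyHighamMary2021
open Literature.ComputerArithmetic.P3109
open Finset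

variable {K : Type*} [Field K] [LinearOrder K] [IsStrictOrderedRing K]

namespace LimitedBits

/-! ### Absorbing states of the limited-randomness tree -/

omit [IsStrictOrderedRing K] in
/-- **Absorbing state**: if from `y` every step's one-step law is the point mass at `y`, the whole tree
from `y` is: `E f(xₙ) = f y` for every `n` and `f`. -/
theorem recExpQ_absorb (F : Finset K) (q : K → K) {y : K} :
    ∀ (g : ℕ → K → K) (n : ℕ) (f : K → K), (∀ k (h : K → K), stepQ F q (g k y) h = h y) →
      recExpQ F q g n f y = f y := by
  intro g n
  induction n generalizing g with
  | zero => intro f _; rfl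
  | succ n ih =>
    intro f habs
    simp only [recExpQ]
    rw [habs 0]
    exact ih _ f fun k h => habs (k + 1) h

omit [IsStrictOrderedRing K] in
/-- One-step criterion, lower neighbour: `dn c = y` and the rule never rounds up. -/
theorem stepQ_absorb_dn (F : Finset K) (q : K → K) {c y : K} (hdn : dn F c = y) (hp : pUpQ F q c = 0)
    (h : K → K) : stepQ F q c h = h y := by
  simp [stepQ, hp, hdn]

omit [IsStrictOrderedRing K] in
/-- One-step criterion, upper neighbour: `up c = y` and the rule always rounds up. -/
theorem stepQ_absorb_up (F : Finset K) (q : K → K) {c y : K} (hup : up F c = y) (hp : pUpQ F q c = 1)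
    (h : K → K) : stepQ F q c h = h y := by
  simp [stepQ, hp, hup]

omit [IsStrictOrderedRing K] in
/-- On the nonnegative side "away from zero" is "up": `P_q(up) = q(θ)`, `θ = pUp c`. -/
theorem pUpQ_of_dn_nonneg (F : Finset K) (q : K → K) {c : K} (h : 0 ≤ dn F c) :
    pUpQ F q c = q (pUp F c) := if_pos h

/-! ### Where the rules are deterministic -/

/-- `SR_ε` rounds away surely once `θ ≥ 1 − ε`. -/
theorem qAway_eq_one {ε θ : K} (h : 1 - ε ≤ θ) : qAway ε θ = 1 :=
  min_eq_left (by linarith)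

section P3109
variable [FloorRing K]

/-- StochasticA never rounds away surely below `θ = 1` (its comparison is `≥ 2^N` on `⌊θ2^N⌋ + R`). -/
theorem probAwayA_lt_one (N : ℕ) {θ : K} (h : θ < 1) : probAwayA N θ < 1 := by
  unfold probAwayA
  have h2 : (0 : K) < 2 ^ N := by positivity
  rw [div_lt_one h2]
  exact (Int.floor_le _).trans_lt (by nlinarith)

/-- StochasticB rounds away surely iff `θ ≥ 1 − 2^{-(N+1)}`. -/
theorem probAwayB_eq_one (N : ℕ) {θ : K} (h : 1 - 1 / 2 ^ (N + 1) ≤ θ) (h1 : θ ≤ 1) :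
    probAwayB N θ = 1 := by
  unfold probAwayB
  have h2 : (0 : K) < 2 ^ N := by positivity
  have hlo : (2 : K) ^ N - 1 / 2 ≤ θ * 2 ^ N := by
    have := mul_le_mul_of_nonneg_right h h2.le
    rw [pow_succ, sub_mul, one_mul, div_mul_eq_mul_div, one_mul,
      show (2 : K) ^ N / (2 ^ N * 2) = 1 / 2 by field_simp] at this
    exact this
  have hhi : θ * 2 ^ N ≤ 2 ^ N := by nlinarith
  have hfl : ⌊θ * 2 ^ N + 1 / 2⌋ = ((2 ^ N : ℕ) : ℤ) := by
    rw [Int.floor_eq_iff]; push_cast; constructor <;> linarith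
  rw [hfl]; push_cast; exact div_self h2.ne'

/-- StochasticC rounds away surely for `θ > 1 − 2^{-(N+1)}` (and at the tie, to even `2^N`, `N ≥ 1`). -/
theorem probAwayC_eq_one (N : ℕ) {θ : K} (h : 1 - 1 / 2 ^ (N + 1) < θ) (h1 : θ ≤ 1) :
    probAwayC N θ = 1 := by
  unfold probAwayC
  have h2 : (0 : K) < 2 ^ N := by positivity
  have hlo : (2 : K) ^ N - 1 / 2 < θ * 2 ^ N := by
    have := mul_lt_mul_of_pos_right h h2
    rw [pow_succ, sub_mul, one_mul, div_mul_eq_mul_div, one_mul,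
      show (2 : K) ^ N / (2 ^ N * 2) = 1 / 2 by field_simp] at this
    exact this
  have hhi : θ * 2 ^ N ≤ 2 ^ N := by nlinarith
  have hab := abs_le.mp (abs_rnite_sub_le (θ * 2 ^ N))
  have hgt : ((2 ^ N : ℕ) : K) - 1 < rnite (θ * 2 ^ N) := by push_cast; linarith [hab.1]
  have hle : (rnite (θ * 2 ^ N) : K) < (2 ^ N : ℕ) + 1 := by push_cast; linarith [hab.2]
  have hgtZ : ((2 ^ N : ℕ) : ℤ) - 1 < rnite (θ * 2 ^ N) := by exact_mod_cast hgt
  have hleZ : rnite (θ * 2 ^ N) < ((2 ^ N : ℕ) : ℤ) + 1 := by exact_mod_cast hle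
  rw [show rnite (θ * 2 ^ N) = ((2 ^ N : ℕ) : ℤ) by omega]; push_cast; exact div_self h2.ne'

end P3109

/-! ### Dead bands: a neighbour of the pre-rounding value is absorbing below the rule's resolution -/

omit [IsStrictOrderedRing K] in
/-- **Lower-neighbour absorption** (the chain wants to move UP from `y = dn c ≥ 0` but the residual is below
the rule's resolution): any rule with `q θ = 0` there makes the step deterministic. StochasticA: `θ < 2^{-N}`;
StochasticB/C: `θ < 2^{-(N+1)}`. -/
theorem absorb_dn_of (F : Finset K) {q : K → K} {c y : K} (hy : 0 ≤ y) (hdn : dn F c = y)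
    (hq : q (pUp F c) = 0) (h : K → K) : stepQ F q c h = h y :=
  stepQ_absorb_dn F q hdn (by rw [pUpQ_of_dn_nonneg F q (hdn ▸ hy), hq]) h

omit [IsStrictOrderedRing K] in
/-- **Upper-neighbour absorption** (the chain wants to move DOWN from `y = up c`, `dn c ≥ 0`, but the
residual exceeds one minus the resolution): any rule with `q θ = 1` there. StochasticB: `θ ≥ 1 − 2^{-(N+1)}`;
StochasticC: `θ > 1 − 2^{-(N+1)}`; `SR_ε`: `θ ≥ 1 − ε`; StochasticA: never (for `θ < 1`). -/
theorem absorb_up_of (F : Finset K) {q : K → K} {c y : K} (hdn : 0 ≤ dn F c) (hup : up F c = y)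
    (hq : q (pUp F c) = 1) (h : K → K) : stepQ F q c h = h y :=
  stepQ_absorb_up F q hup (by rw [pUpQ_of_dn_nonneg F q hdn, hq]) h

omit [IsStrictOrderedRing K] in
/-- **EMA form**: for the SR-EMA `x ← round_q(βx + (1−β)μ)` the one-step condition at `c = βy + (1−β)μ`
makes `y` absorbing for every horizon. In a cell of width `Δ` next to `y` the residual is
`θ = (1−β)(μ − y)/Δ` (from below) or `1 − (1−β)(y − μ)/Δ` (from above), so StochasticB/C with `N` bits
are stuck whenever `(1−β)|y − μ| ≤ 2^{-(N+1)}Δ` — the RN dead band `(1−β)|y − μ| < Δ/2` shrunk `2^N`-fold. -/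
theorem ema_absorb_of_step (F : Finset K) (q : K → K) {β μ y : K}
    (h1 : ∀ h : K → K, stepQ F q (β * y + (1 - β) * μ) h = h y) (n : ℕ) (f : K → K) :
    recExpQ F q (affMap (fun _ => β) (fun _ => (1 - β) * μ)) n f y = f y :=
  recExpQ_absorb F q _ n f fun k h => by rw [affMap_apply]; exact h1 h

end LimitedBits

/-! ### FP4 (E2M1) kernel witnesses: EMA `β = 3/4`, `μ = 3/2` -/

namespace FP4

open LimitedBits

/-- The SR-EMA map `x ↦ 3/4·x + 1/4·3/2` of files III / XLVIII. -/
def ema34 : ℕ → ℚ → ℚ := affMap (fun _ => 3/4) (fun _ => (1 - 3/4) * (3/2))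

/-- One-step facts at the neighbours of `μ = 3/2` (kernel): from `2` the pre-rounding value is `15/8`
(cell `[3/2, 2]`, residual `3/4`); from `1` it is `9/8` (cell `[1, 3/2]`, residual `1/4`). -/
theorem ema34_cells : up e2m1 (15/8 : ℚ) = 2 ∧ dn e2m1 (15/8 : ℚ) = 3/2 ∧ pUp e2m1 (15/8 : ℚ) = 3/4 ∧
    up e2m1 (9/8 : ℚ) = 3/2 ∧ dn e2m1 (9/8 : ℚ) = 1 ∧ pUp e2m1 (9/8 : ℚ) = 1/4 := by
  decide +kernel

/-- **One bit, StochasticB: `2` is absorbing for ever** (`⌊3/4·2 + 1/2⌋/2 = 1`): `E f(xₙ) = f 2`. -/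
theorem e2m1_ema_B1_stuck_two (n : ℕ) (f : ℚ → ℚ) : recExpQ e2m1 (probAwayB 1) ema34 n f 2 = f 2 :=
  ema_absorb_of_step e2m1 _ (fun h => by
    rw [show (3/4 : ℚ) * 2 + (1 - 3/4) * (3/2) = 15/8 by norm_num]
    exact stepQ_absorb_up e2m1 _ ema34_cells.1 (by decide +kernel) h) n f

/-- **One bit, StochasticC: `2` AND `1` are absorbing** (`rnite(3/2) = 2`, `rnite(1/2) = 0`: ties to even). -/
theorem e2m1_ema_C1_stuck (n : ℕ) (f : ℚ → ℚ) :
    recExpQ e2m1 (probAwayC 1) ema34 n f 2 = f 2 ∧ recExpQ e2m1 (probAwayC 1) ema34 n f 1 = f 1 :=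
  ⟨ema_absorb_of_step e2m1 _ (fun h => by
      rw [show (3/4 : ℚ) * 2 + (1 - 3/4) * (3/2) = 15/8 by norm_num]
      exact stepQ_absorb_up e2m1 _ ema34_cells.1 (by decide +kernel) h) n f,
    ema_absorb_of_step e2m1 _ (fun h => by
      rw [show (3/4 : ℚ) * 1 + (1 - 3/4) * (3/2) = 9/8 by norm_num]
      exact stepQ_absorb_dn e2m1 _ ema34_cells.2.2.2.2.1 (by decide +kernel) h) n f⟩

/-- **One bit, StochasticA: `1` is absorbing** (`⌊1/4·2⌋ = 0`: toward zero surely) — A's band is one-sided. -/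
theorem e2m1_ema_A1_stuck_one (n : ℕ) (f : ℚ → ℚ) : recExpQ e2m1 (probAwayA 1) ema34 n f 1 = f 1 :=
  ema_absorb_of_step e2m1 _ (fun h => by
    rw [show (3/4 : ℚ) * 1 + (1 - 3/4) * (3/2) = 9/8 by norm_num]
    exact stepQ_absorb_dn e2m1 _ ema34_cells.2.2.2.2.1 (by decide +kernel) h) n f

/-- The complementary one-step laws (kernel): StochasticA and exact SR DO leave `2` (down-probability `1/2`,
`1/4`), StochasticB leaves `1` (up-probability `1/2`), and the true target `3/2 ∈ F` is fixed by all. -/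
theorem e2m1_ema_one_bit_moves :
    recExpQ e2m1 (probAwayA 1) ema34 1 (fun v => if v = 3/2 then 1 else 0) 2 = 1/2 ∧
    recExp e2m1 ema34 1 (fun v => if v = 3/2 then 1 else 0) 2 = 1/4 ∧
    recExpQ e2m1 (probAwayB 1) ema34 1 (fun v => if v = 3/2 then 1 else 0) 1 = 1/2 ∧
    recExpQ e2m1 (probAwayA 1) ema34 1 (fun v => v) (3/2) = 3/2 ∧
    recExpQ e2m1 (probAwayB 1) ema34 1 (fun v => v) (3/2) = 3/2 ∧
    recExpQ e2m1 (probAwayC 1) ema34 1 (fun v => v) (3/2) = 3/2 := by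
  decide +kernel

/-- **Two bits dissolve both spurious states**: from `2` and from `1` every rule moves toward `3/2` with
positive probability (`1/4` each; residuals `3/4`, `1/4` are 2-bit dyadic, so the rules are exact there). -/
theorem e2m1_ema_two_bits_move :
    recExpQ e2m1 (probAwayA 2) ema34 1 (fun v => if v = 3/2 then 1 else 0) 2 = 1/4 ∧
    recExpQ e2m1 (probAwayB 2) ema34 1 (fun v => if v = 3/2 then 1 else 0) 2 = 1/4 ∧
    recExpQ e2m1 (probAwayC 2) ema34 1 (fun v => if v = 3/2 then 1 else 0) 2 = 1/4 ∧
    recExpQ e2m1 (probAwayA 2) ema34 1 (fun v => if v = 3/2 then 1 else 0) 1 = 1/4 ∧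
    recExpQ e2m1 (probAwayB 2) ema34 1 (fun v => if v = 3/2 then 1 else 0) 1 = 1/4 ∧
    recExpQ e2m1 (probAwayC 2) ema34 1 (fun v => if v = 3/2 then 1 else 0) 1 = 1/4 := by
  decide +kernel

/-- One step from `3` (pre-rounding `21/8`, cell `[2, 3]`, residual `5/8`): kernel facts. -/
theorem ema34_cell_three : up e2m1 (21/8 : ℚ) = 3 ∧ dn e2m1 (21/8 : ℚ) = 2 ∧
    pUpQ e2m1 (probAwayB 1) (21/8 : ℚ) = 1/2 ∧ pUpQ e2m1 (probAwayA 1) (21/8 : ℚ) = 1/2 ∧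
    pUpQ e2m1 (probAwayA 1) (15/8 : ℚ) = 1/2 := by
  decide +kernel

/-- **One bit, StochasticB from `x₀ = 3`: `E xₙ = 2 + 2^{-n}`** — the chain falls from `3` to the spurious
absorbing state `2` and stays: long-run bias `+1/2 = one cell` above `μ = 3/2` (exact SR: `E xₙ → 3/2`,
`SRRecursionAbsorb`; RN: stuck at `3`, file III). -/
theorem e2m1_ema_B1_mean_from_three (n : ℕ) :
    recExpQ e2m1 (probAwayB 1) ema34 n (fun v => v) 3 = 2 + 1 / 2 ^ n := by
  induction n with
  | zero => norm_num [recExpQ]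
  | succ n ih =>
    have hshift : (fun i => ema34 (i + 1)) = ema34 := rfl
    simp only [recExpQ]
    rw [hshift, show ema34 0 3 = 21/8 by norm_num [ema34, affMap_apply]]
    simp only [stepQ]
    have h2 : recExpQ e2m1 (probAwayB 1) ema34 n (fun v => v) 2 = 2 := e2m1_ema_B1_stuck_two n _
    rw [ema34_cell_three.1, ema34_cell_three.2.1, ema34_cell_three.2.2.1, ih, h2]
    rw [pow_succ]; field_simp; ring

/-- One bit, StochasticA from `2`: `E xₙ = 3/2 + 2^{-(n+1)}` (leaves `2` at rate `1/2`, then fixed at `3/2`). -/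
theorem e2m1_ema_A1_mean_from_two (n : ℕ) :
    recExpQ e2m1 (probAwayA 1) ema34 n (fun v => v) 2 = 3/2 + 1 / 2 ^ (n + 1) := by
  induction n with
  | zero => norm_num [recExpQ]
  | succ n ih =>
    have hshift : (fun i => ema34 (i + 1)) = ema34 := rfl
    have hfix : ∀ m, recExpQ e2m1 (probAwayA 1) ema34 m (fun v => v) (3/2) = 3/2 := fun m =>
      ema_absorb_of_step e2m1 _ (fun h => by
        rw [show (3/4 : ℚ) * (3/2) + (1 - 3/4) * (3/2) = 3/2 by norm_num]
        exact stepQ_absorb_dn e2m1 _ (by decide +kernel) (by decide +kernel) h) m _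
    simp only [recExpQ]
    rw [hshift, show ema34 0 2 = 15/8 by norm_num [ema34, affMap_apply]]
    simp only [stepQ]
    rw [ema34_cells.1, ema34_cells.2.1, ema34_cell_three.2.2.2.2, ih, hfix n]
    rw [pow_succ, pow_succ]; field_simp; ring

/-- **One bit, StochasticA from `x₀ = 3`: `E xₙ = 3/2 + (n + 3)/2^{n+1} → 3/2`** — no spurious state on the
way down, the limit is the target (bias `→ 0`), in contrast with StochasticB/C. -/
theorem e2m1_ema_A1_mean_from_three (n : ℕ) :
    recExpQ e2m1 (probAwayA 1) ema34 n (fun v => v) 3 = 3/2 + (n + 3) / 2 ^ (n + 1) := by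
  induction n with
  | zero => norm_num [recExpQ]
  | succ n ih =>
    have hshift : (fun i => ema34 (i + 1)) = ema34 := rfl
    simp only [recExpQ]
    rw [hshift, show ema34 0 3 = 21/8 by norm_num [ema34, affMap_apply]]
    simp only [stepQ]
    rw [ema34_cell_three.1, ema34_cell_three.2.1, ema34_cell_three.2.2.2.1, ih,
      e2m1_ema_A1_mean_from_two n]
    rw [pow_succ, pow_succ]; push_cast; field_simp; ring

end FP4

end Summit.Ventures.CertifiedArithmetic.LowPrec.SR
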